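import Literature.Geometry.Lorentzian.SecondFundamentalFormLift
import Literature.Geometry.Lorentzian.ChartCurvature
import Literature.Geometry.Lorentzian.SchwarzschildThroatImmersion
import Literature.Geometry.Lorentzian.ModelDataProofs
import HarnessLib

/-!
# The minimal throat of the time-symmetric Schwarzschild data is a MOTS (discharge of `Schwarzschild.isMOTSInData_throat`)

Discharge of the named fact `Schwarzschild.isMOTSInData_throat` (`ModelData.lean`): for `M > 0`
the coordinate sphere `‖y‖ = M/2` of the time-symmetric Schwarzschild data
`(E3 ∖ {0}, ψ⁴ δ, 0)`, `ψ = 1 + M/(2‖y‖)`, parametrised by the throat embedding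
`ω ↦ (M/2) ω` of the unit sphere with outward unit normal `ν(ω) = ω/4`, is a marginally outer
trapped surface: `θ⁺ = tr_S k + H = 0`. Since `k = 0`, this is the statement that the throat is a
minimal surface of `ψ⁴ δ`; in fact it is **totally geodesic** — the second fundamental form
`K_ν` vanishes identically (the throat is the fixed-point set of the inversion isometry
`y ↦ (M/2)² y/‖y‖²`). MTW 1973, §31.7; Bray, J. Diff. Geom. 59 (2001), §1 (the horizon of the
Riemannian Penrose rigidity model is the minimal sphere `r = M/2` of the spatial Schwarzschild
metric).

## Proof

1. **The second fundamental form of a map from an arbitrary manifold into a chart domain, in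
   coordinates** (`OpensChart.secondFundamentalForm_eq_mfderiv`, `SecondFundamentalFormLift.lean`):
   `K_ν(v, w) = g_{f y}(dN_y v + Γ_{f y}(N y)(df_y v), df_y w)` (O'Neill 1983, Ch. 4, Lemma 4.1,
   read in the constant frame of the chart), for the throat embedding `f` of the unit sphere and
   the normal `N(ω) = ω/4`.
2. **The throat is totally geodesic** (`Schwarzschild.secondFundamentalForm_throat_eq_zero`): at
   `x = (M/2) ω`, with `u = dι_ω v ⟂ ω` (`range_mfderiv_coe_sphere`), `dN v = u/4`,
   `df v = (M/2) u`, and by the Christoffel symbols of the conformally flat metric `φ δ`, `φ = ψ⁴`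
   (`OpensChart.christoffel_conformal`: `Γ(Y, X) = θ(X) Y + θ(Y) X − ⟪X, Y⟫ θ♯`, `θ = Dφ/(2φ)`):
   `θ(u) = 0` (`ψ` is radial), `⟪u, ω⟫ = 0`, and `θ_x(ω/4) = −1/(2M)` (`ψ(x) = 2`,
   `∂_r ψ = −M/(2r²) = −2/M` at `r = M/2`), so `Γ(N)(df v) = −u/4 = −dN v` and `K_ν(v, w) = 0`.
3. Hence `H = tr_{f^*h} K_ν = 0`, and `tr_S k = 0` as `k = 0`: `θ⁺ = 0`
   (`Schwarzschild.isMOTSInData_throat_holds`).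

* `Schwarzschild.hasFDerivAt_conformalFactor_pow_four` — `D(ψ⁴)_x = 4ψ³ ψ'(‖x‖) ⟪x, ·⟫/‖x‖`;
* `Schwarzschild.secondFundamentalForm_throat_eq_zero`, `Schwarzschild.meanCurvature_throat_eq_zero`;
* `Schwarzschild.isMOTSInData_throat_holds` — **the named fact, verbatim**.

Everything is proved; no definitions, no named facts.

## References

* C. W. Misner, K. S. Thorne, J. A. Wheeler, *Gravitation*, Freeman 1973, §31.7.
* H. L. Bray, *Proof of the Riemannian Penrose inequality using the positive mass theorem*,
  J. Differential Geom. 59 (2001), §1.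
* B. O'Neill, *Semi-Riemannian geometry with applications to relativity*, Academic Press 1983,
  Ch. 3, Prop. 3.13; Ch. 4, Lemma 4.1 and Lemma 4.4.
-/

noncomputable section

open Bundle TopologicalSpace Manifold Set Module Metric
open scoped ContDiff Topology RealInnerProductSpace

-- instance search through the nested operator type of the metric components (as in `ChartCurvature.lean`)
set_option maxSynthPendingDepth 3

namespace Literature.Geometry.Lorentzian

/-! ### The throat of the time-symmetric Schwarzschild data -/

namespace Schwarzschild

/-- The model dimension count of the unit sphere of `E3` (Mathlib `finrank_euclideanSpace_fin`),
the instance hypothesis of Mathlib's sphere charts. [folklore] -/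
private theorem fact_finrank_E3 : Fact (finrank ℝ E3 = 2 + 1) := ⟨finrank_euclideanSpace_fin⟩

/-- **Tangent vectors of the unit sphere are orthogonal to the position vector**:
`⟪ω, dι_ω v⟫ = 0` (Mathlib `range_mfderiv_coe_sphere`: the range of `dι_ω` is `(ℝ ω)ᗮ`).
[folklore] -/
private theorem inner_mfderiv_coe_sphere (y : sphere (0 : E3) 1) (v : TangentSpace (𝓡 2) y) :
    ⟪(y : E3), mfderiv (𝓡 2) 𝓘(ℝ, E3) (Subtype.val : sphere (0 : E3) 1 → E3) y v⟫ = 0 := by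
  haveI := fact_finrank_E3
  have hmem : mfderiv (𝓡 2) 𝓘(ℝ, E3) (Subtype.val : sphere (0 : E3) 1 → E3) y v ∈
      (ℝ ∙ (y : E3))ᗮ := by
    rw [← range_mfderiv_coe_sphere (n := 2) y]
    exact ⟨v, rfl⟩
  exact Submodule.mem_orthogonal_singleton_iff_inner_right.mp hmem

/-- **The differential of the throat normal `ν(ω) = ω/4`** read in `E3` is `dι/4`.
MTW 1973, §31.7. [cite: MTW1973, §31.7] -/
theorem mfderiv_throatNormal (M : ℝ) (hM : 0 < M) (y : sphere (0 : E3) 1) :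
    mfderiv (𝓡 2) 𝓘(ℝ, E3) (fun p : sphere (0 : E3) 1 ↦ (throatNormal M hM p : E3)) y =
      (4 : ℝ)⁻¹ • mfderiv (𝓡 2) 𝓘(ℝ, E3) (Subtype.val : sphere (0 : E3) 1 → E3) y := by
  haveI := fact_finrank_E3
  exact (((contMDiff_coe_sphere (m := 1) y).mdifferentiableAt one_ne_zero).hasMFDerivAt.const_smul
    (4 : ℝ)⁻¹).mfderiv

/-- **The differential of `ψ⁴`**, `ψ = 1 + M/(2‖x‖)` the conformal factor: at `x ≠ 0`,
`D(ψ⁴)_x(w) = −(2M ψ(x)³/‖x‖³) ⟪x, w⟫` (`ψ` is radial with `∂_r ψ = −M/(2r²)`). MTW 1973,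
(31.22). [cite: MTW1973, (31.22)] -/
theorem hasFDerivAt_conformalFactor_pow_four (M : ℝ) {x : E3} (hx : x ≠ 0) :
    HasFDerivAt (fun z : E3 ↦ conformalFactor M z ^ 4)
      ((-(2 * M * conformalFactor M x ^ 3 / ‖x‖ ^ 3)) • (innerSL ℝ x : E3 →L[ℝ] ℝ)) x := by
  have hnx : ‖x‖ ≠ 0 := norm_ne_zero_iff.mpr hx
  have hnpos : 0 < ‖x‖ := norm_pos_iff.mpr hx
  -- the norm is differentiable off the origin, `D‖·‖_x = ⟪x, ·⟫/‖x‖`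
  have hn : HasFDerivAt (fun z : E3 ↦ ‖z‖) (‖x‖⁻¹ • (innerSL ℝ x : E3 →L[ℝ] ℝ)) x := by
    have h1 := (hasStrictFDerivAt_norm_sq x).hasFDerivAt
    have h2 : HasDerivAt (fun r : ℝ ↦ √r) (1 / (2 * √(‖x‖ ^ 2))) (‖x‖ ^ 2) :=
      Real.hasDerivAt_sqrt (by positivity)
    have h3 := h2.comp_hasFDerivAt x h1
    have hfun : ((fun r : ℝ ↦ √r) ∘ fun z : E3 ↦ ‖z‖ ^ 2) = fun z : E3 ↦ ‖z‖ :=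
      funext fun z ↦ Real.sqrt_sq (norm_nonneg z)
    rw [hfun, Real.sqrt_sq (norm_nonneg x),
      ← Nat.cast_smul_eq_nsmul ℝ 2 (innerSL ℝ x : E3 →L[ℝ] ℝ), smul_smul] at h3
    refine h3.congr_fderiv ?_
    congr 1
    push_cast
    field_simp
  -- the radial profile `r ↦ (1 + M/(2r))⁴`
  have hR : HasDerivAt (fun r : ℝ ↦ 1 + M / 2 * r⁻¹) (M / 2 * -(‖x‖ ^ 2)⁻¹) ‖x‖ :=
    ((hasDerivAt_inv hnx).const_mul (M / 2)).const_add 1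
  have hP := (hR.fun_pow 4).comp_hasFDerivAt x hn
  have hfun : ((fun r : ℝ ↦ (1 + M / 2 * r⁻¹) ^ 4) ∘ fun z : E3 ↦ ‖z‖) =
      fun z : E3 ↦ conformalFactor M z ^ 4 := by
    funext z
    simp only [Function.comp_apply, conformalFactor_apply]
    ring
  rw [hfun, smul_smul] at hP
  refine hP.congr_fderiv ?_
  congr 1
  rw [conformalFactor_apply]
  norm_num
  field_simp
  ring

/-- **`D(ψ⁴)_x(w) = −(2M ψ³/‖x‖³) ⟪x, w⟫`**, the `fderiv` form of
`hasFDerivAt_conformalFactor_pow_four`. [cite: MTW1973, (31.22)] -/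
theorem fderiv_conformalFactor_pow_four (M : ℝ) {x : E3} (hx : x ≠ 0) (w : E3) :
    fderiv ℝ (fun z : E3 ↦ conformalFactor M z ^ 4) x w =
      -(2 * M * conformalFactor M x ^ 3 / ‖x‖ ^ 3) * ⟪x, w⟫ := by
  rw [(hasFDerivAt_conformalFactor_pow_four M hx).fderiv]
  rfl

/-- **The throat is totally geodesic**: the second fundamental form of the throat embedding
`ω ↦ (M/2) ω` with respect to `ν = ω/4` vanishes identically, for `M > 0`. In the chart formula
`K_ν(v, w) = g(dN v + Γ(N)(df v), df w)` (`OpensChart.secondFundamentalForm_eq_mfderiv`)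
with `u = dι v ⟂ ω`: `dN v = u/4`, `df v = (M/2) u`, and `Γ(N)(df v) = θ(df v) N + θ(N) df v −
⟪df v, N⟫ θ♯ = θ(N) (M/2) u = −u/4` (`OpensChart.christoffel_conformal` for `ψ⁴ δ`, with
`θ = D(ψ⁴)/(2ψ⁴)`, `θ(u) = 0`, `θ_x(ω/4) = −1/(2M)` at `‖x‖ = M/2` where `ψ = 2`). MTW 1973,
§31.7 (the throat `r̄ = M/2` is a minimal surface, fixed by the inversion isometry); Bray 2001,
§1. [cite: MTW1973, §31.7] -/
theorem secondFundamentalForm_throat_eq_zero {M : ℝ} (hM : 0 < M)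
    [(PseudoRiemannianMetric.ofRiemannian (timeSymmetricData M hM.le).h).HasLeviCivita]
    (y : sphere (0 : E3) 1) (v w : TangentSpace (𝓡 2) y) :
    (PseudoRiemannianMetric.ofRiemannian (timeSymmetricData M hM.le).h).secondFundamentalForm
      (𝓡 2) (throatEmbed M hM) (throatNormal M hM) y v w = 0 := by
  haveI := fact_finrank_E3
  set g := PseudoRiemannianMetric.ofRiemannian (timeSymmetricData M hM.le).h with hg
  set φ : E3 → ℝ := fun z ↦ conformalFactor M z ^ 4 with hφ
  set G : E3 → E3 →L[ℝ] E3 →L[ℝ] ℝ := fun z ↦ φ z • (innerSL ℝ : E3 →L[ℝ] E3 →L[ℝ] ℝ) with hGdef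
  have hG : ∀ x : puncturedSlice, g.val x = G x := fun _ ↦ rfl
  have hM0 : M ≠ 0 := hM.ne'
  have hy1 : ‖(y : E3)‖ = 1 := norm_eq_of_mem_sphere y
  -- differentiability data for the chart formula
  have hf : MDifferentiableAt (𝓡 2) 𝓘(ℝ, E3) (throatEmbed M hM) y :=
    (contMDiff_throatEmbed M hM 1 y).mdifferentiableAt one_ne_zero
  have hNd : MDifferentiableAt (𝓡 2) 𝓘(ℝ, E3)
      (fun p : sphere (0 : E3) 1 ↦ (throatNormal M hM p : E3)) y :=
    ((contMDiff_coe_sphere (m := 1) y).mdifferentiableAt one_ne_zero).const_smul (4 : ℝ)⁻¹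
  have hx0 : (throatEmbed M hM y : E3) ≠ 0 := by
    rw [← norm_pos_iff, norm_coe_throatEmbed]; positivity
  have hφd : DifferentiableAt ℝ φ (throatEmbed M hM y : E3) :=
    (hasFDerivAt_conformalFactor_pow_four M hx0).differentiableAt
  have hGd : DifferentiableAt ℝ G (throatEmbed M hM y : E3) :=
    OpensChart.differentiableAt_conformal (G := G) (φ := φ)
      (δ := (innerSL ℝ : E3 →L[ℝ] E3 →L[ℝ] ℝ)) (fun _ ↦ rfl) hφd
  -- the chart formula `K(v, w) = g(dN v + Γ(N)(df v), df w)`, with `dN = dι/4`, `df = (M/2) dι`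
  rw [OpensChart.secondFundamentalForm_eq_mfderiv (IN := 𝓡 2) hG BoundarylessManifold.isInteriorPoint
    hf hNd hGd v w, mfderiv_throatEmbed M hM y, mfderiv_throatNormal M hM y]
  set x : puncturedSlice := throatEmbed M hM y with hxdef
  set u : E3 := mfderiv (𝓡 2) 𝓘(ℝ, E3) (Subtype.val : sphere (0 : E3) 1 → E3) y v with hu
  change g.val x ((4 : ℝ)⁻¹ • u + OpensChart.christoffel g G x ((4 : ℝ)⁻¹ • (y : E3))
      ((M / 2 : ℝ) • u))
    (((M / 2 : ℝ) • mfderiv (𝓡 2) 𝓘(ℝ, E3) (Subtype.val : sphere (0 : E3) 1 → E3) y) w) = 0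
  -- the point `x = (M/2) ω`: `ψ = 2`, `φ = 16`, `Dφ_x(w) = −(128/M²) ⟪x, w⟫`
  have hxy : (x : E3) = (M / 2 : ℝ) • (y : E3) := coe_throatEmbed M hM y
  have hnx : ‖(x : E3)‖ = M / 2 := norm_coe_throatEmbed M hM y
  have hyu : ⟪(y : E3), u⟫ = 0 := inner_mfderiv_coe_sphere y v
  have hψ : conformalFactor M (x : E3) = 2 := by
    rw [conformalFactor_apply, hnx]
    field_simp
    ring
  have hφx : φ (x : E3) = 16 := by
    simp only [hφ, hψ]
    norm_num
  have hφx0 : φ (x : E3) ≠ 0 := by rw [hφx]; norm_num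
  have hDφ : ∀ w' : E3, fderiv ℝ φ (x : E3) w' = -(128 / M ^ 2) * ⟪(x : E3), w'⟫ := fun w' ↦ by
    simp only [hφ]
    rw [fderiv_conformalFactor_pow_four M hx0, hψ, hnx]
    congr 1
    field_simp
    ring
  have hDφu : fderiv ℝ φ (x : E3) u = 0 := by
    rw [hDφ, hxy, real_inner_smul_left, hyu, mul_zero, mul_zero]
  have hxN : ⟪(x : E3), (4 : ℝ)⁻¹ • (y : E3)⟫ = M / 8 := by
    rw [hxy, real_inner_smul_left, real_inner_smul_right, real_inner_self_eq_norm_sq, hy1]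
    ring
  have hDφN : fderiv ℝ φ (x : E3) ((4 : ℝ)⁻¹ • (y : E3)) = -(16 / M) := by
    rw [hDφ, hxN]
    field_simp
    ring
  -- the Christoffel symbols of `φ δ` at `x` (`OpensChart.christoffel_conformal`)
  set θ : E3 → E3 →L[ℝ] ℝ := fun z ↦ (2 * φ z)⁻¹ • fderiv ℝ φ z with hθ
  set t : E3 → E3 := fun z ↦ (InnerProductSpace.toDual ℝ E3).symm (θ z) with ht
  have htθ : ∀ (z : E3) (w' : E3), ⟪t z, w'⟫ = θ z w' := fun z w' ↦ by
    simp only [ht, InnerProductSpace.toDual_symm_apply]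
  have hθapply : ∀ w' : E3, θ (x : E3) w' = (2 * φ (x : E3))⁻¹ * fderiv ℝ φ (x : E3) w' :=
    fun _ ↦ rfl
  have hθu : θ (x : E3) ((M / 2 : ℝ) • u) = 0 := by
    rw [hθapply, map_smul, smul_eq_mul, hDφu, mul_zero, mul_zero]
  have hθN : θ (x : E3) ((4 : ℝ)⁻¹ • (y : E3)) = -(1 / (2 * M)) := by
    rw [hθapply, hDφN, hφx]
    field_simp
  have hXN : ⟪(M / 2 : ℝ) • u, (4 : ℝ)⁻¹ • (y : E3)⟫ = 0 := by
    rw [real_inner_smul_left, real_inner_smul_right, inner_eq_zero_symm.mp hyu, mul_zero,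
      mul_zero]
  have hΓ := OpensChart.christoffel_conformal (g := g) (G := G) (φ := φ)
    (δ := (innerSL ℝ : E3 →L[ℝ] E3 →L[ℝ] ℝ)) (fun _ _ ↦ rfl) (fun _ ↦ rfl) hG htθ x hφx0 hφd rfl
    ((4 : ℝ)⁻¹ • (y : E3)) ((M / 2 : ℝ) • u)
  -- `dN v + Γ(N)(df v) = u/4 − u/4 = 0`
  have hc : (4 : ℝ)⁻¹ + -(1 / (2 * M)) * (M / 2) = 0 := by
    field_simp
    ring
  have h0 : g.val x (0 : E3) = 0 := map_zero _
  rw [hΓ, hθu, hθN, hXN, zero_smul, zero_add, zero_smul, sub_zero, smul_smul, ← add_smul, hc,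
    zero_smul, h0]
  rfl

/-- **The throat is a minimal surface**: its mean curvature `H = tr K_ν` vanishes (indeed
`K_ν = 0`, `secondFundamentalForm_throat_eq_zero`). MTW 1973, §31.7; Bray 2001, §1.
[cite: MTW1973, §31.7] -/
theorem meanCurvature_throat_eq_zero {M : ℝ} (hM : 0 < M)
    (hpb : PseudoRiemannianMetric.contMDiff_pullbackBilin 𝓘(ℝ, E3) puncturedSlice (𝓡 2)
      (sphere (0 : E3) 1) ∞)
    (hf : (PseudoRiemannianMetric.ofRiemannian
      (timeSymmetricData M hM.le).h).IsSpacelikeImmersion (𝓡 2) (throatEmbed M hM))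
    [(PseudoRiemannianMetric.ofRiemannian (timeSymmetricData M hM.le).h).HasLeviCivita]
    (y : sphere (0 : E3) 1) :
    (PseudoRiemannianMetric.ofRiemannian (timeSymmetricData M hM.le).h).meanCurvature
      (throatEmbed M hM) hpb hf (throatNormal M hM) y = 0 := by
  have h0 : (PseudoRiemannianMetric.ofRiemannian (timeSymmetricData M hM.le).h).secondFundamentalForm
      (𝓡 2) (throatEmbed M hM) (throatNormal M hM) y = 0 :=
    LinearMap.ext fun v ↦ LinearMap.ext fun w ↦ secondFundamentalForm_throat_eq_zero hM y v w
  rw [PseudoRiemannianMetric.meanCurvature, h0, PseudoRiemannianMetric.trace, LinearMap.comp_zero,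
    map_zero]

/-- **Discharge of the named fact `Schwarzschild.isMOTSInData_throat`** (`ModelData.lean`),
verbatim: for `M > 0`, under its leading binders (the pullback-smoothness fact `hpb`, the
immersion fact `hf` — itself the theorem `isSpacelikeImmersion_throatEmbed_holds` — and the
Levi-Civita hypothesis of the data metric), the throat `‖y‖ = M/2` with outward normal `ν = ω/4`
is a MOTS of the time-symmetric Schwarzschild data: `θ⁺ = tr_S k + H = 0`, since `k = 0` and
`H = 0` (`meanCurvature_throat_eq_zero`). MTW 1973, §31.7; Bray, J. Diff. Geom. 59 (2001), §1;
Huisken–Ilmanen, J. Diff. Geom. 59 (2001), §1. [cite: MTW1973, §31.7] -/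
theorem isMOTSInData_throat_holds : ∀ M : ℝ, isMOTSInData_throat M := by
  intro M hM hpb hf _ y
  show traceKOnSurface (timeSymmetricData M hM.le).h (timeSymmetricData M hM.le).k (throatEmbed M hM)
      hpb hf y +
    (PseudoRiemannianMetric.ofRiemannian (timeSymmetricData M hM.le).h).meanCurvature
      (throatEmbed M hM) hpb hf (throatNormal M hM) y = 0
  rw [meanCurvature_throat_eq_zero hM hpb hf y, add_zero, traceKOnSurface]
  have hk : pullbackBilin (I := 𝓘(ℝ, E3)) (I' := 𝓡 2) (throatEmbed M hM)
      (timeSymmetricData M hM.le).k y = 0 := by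
    ext v w
    rw [pullbackBilin_apply, show (timeSymmetricData M hM.le).k (throatEmbed M hM y) = 0 from rfl]
    rfl
  rw [hk, PseudoRiemannianMetric.trace]
  have h0 : ((0 : TangentSpace (𝓡 2) y →L[ℝ] TangentSpace (𝓡 2) y →L[ℝ] ℝ)).toLinearMap₁₂ = 0 :=
    LinearMap.ext fun v ↦ LinearMap.ext fun w ↦ rfl
  rw [h0, LinearMap.comp_zero, map_zero]

end Schwarzschild

end Literature.Geometry.Lorentzian

end
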